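import Summits.MatrixMultiplication.OmegaCensus.SmallFormats.MatMul22nRankGF7Slack5Search
import HarnessLib

/-!
# ω-census family (a): replay of the slack-5 search certificate, CHECK A part 2 of 12 (elements `28 ≤ h < 56`)

Cell `pub-omega` (unit `pub-omega-tensor-g16`), topic `Summits/MatrixMultiplication/OmegaCensus` (sub-folder `SmallFormats`).
Framing (verbatim): lottery ticket; floor = certified bounds/negative ranges. HONEST FRAMING: machine-generated kernel replay
(`pub-omega-tensor-g16/code/gen5_runs.py`): `levelsOK5n h = true` for the elements `28 ≤ h < 56` of `PGL₂(7)`: for every slot `(c, h)`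
(`c < 656`) and bucket level, if the key of its column is visited then the bucket holds an entry with that column (SIMD key planes,
`MatMul22nRankGF7Plane`). Meaning: `slotOK5_of_levelsOK5` (`MatMul22nRankGF7Slack5SearchSound`). Nothing here is progress on `ω`.
-/

namespace Summit.MatrixMultiplication.OmegaCensus.SmallFormats

set_option Elab.async false

set_option maxRecDepth 100000 in
set_option maxHeartbeats 400000000 in
/-- Elements `28 ≤ h < 32`. -/
theorem levelsOK5_ok_28_32 : ∀ h : Fin 336, 28 ≤ h.val → h.val < 32 → levelsOK5n h.val = true := by decide +kernel

set_option maxRecDepth 100000 in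
set_option maxHeartbeats 400000000 in
/-- Elements `32 ≤ h < 36`. -/
theorem levelsOK5_ok_32_36 : ∀ h : Fin 336, 32 ≤ h.val → h.val < 36 → levelsOK5n h.val = true := by decide +kernel

set_option maxRecDepth 100000 in
set_option maxHeartbeats 400000000 in
/-- Elements `36 ≤ h < 40`. -/
theorem levelsOK5_ok_36_40 : ∀ h : Fin 336, 36 ≤ h.val → h.val < 40 → levelsOK5n h.val = true := by decide +kernel

set_option maxRecDepth 100000 in
set_option maxHeartbeats 400000000 in
/-- Elements `40 ≤ h < 44`. -/
theorem levelsOK5_ok_40_44 : ∀ h : Fin 336, 40 ≤ h.val → h.val < 44 → levelsOK5n h.val = true := by decide +kernel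

set_option maxRecDepth 100000 in
set_option maxHeartbeats 400000000 in
/-- Elements `44 ≤ h < 48`. -/
theorem levelsOK5_ok_44_48 : ∀ h : Fin 336, 44 ≤ h.val → h.val < 48 → levelsOK5n h.val = true := by decide +kernel

set_option maxRecDepth 100000 in
set_option maxHeartbeats 400000000 in
/-- Elements `48 ≤ h < 52`. -/
theorem levelsOK5_ok_48_52 : ∀ h : Fin 336, 48 ≤ h.val → h.val < 52 → levelsOK5n h.val = true := by decide +kernel

set_option maxRecDepth 100000 in
set_option maxHeartbeats 400000000 in
/-- Elements `52 ≤ h < 56`. -/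
theorem levelsOK5_ok_52_56 : ∀ h : Fin 336, 52 ≤ h.val → h.val < 56 → levelsOK5n h.val = true := by decide +kernel

/-- CHECK A for the elements `28 ≤ h < 56`. -/
theorem levelsOK5_run_2 : ∀ h : Fin 336, 28 ≤ h.val → h.val < 56 → levelsOK5n h.val = true := by
  intro h hlo hhi
  by_cases h32 : h.val < 32
  · exact levelsOK5_ok_28_32 h (by omega) h32
  by_cases h36 : h.val < 36
  · exact levelsOK5_ok_32_36 h (by omega) h36
  by_cases h40 : h.val < 40
  · exact levelsOK5_ok_36_40 h (by omega) h40
  by_cases h44 : h.val < 44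
  · exact levelsOK5_ok_40_44 h (by omega) h44
  by_cases h48 : h.val < 48
  · exact levelsOK5_ok_44_48 h (by omega) h48
  by_cases h52 : h.val < 52
  · exact levelsOK5_ok_48_52 h (by omega) h52
  exact levelsOK5_ok_52_56 h (by omega) hhi

end Summit.MatrixMultiplication.OmegaCensus.SmallFormats
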